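/-
Copyright (c) 2026 the pub-hodgecm-mathlib formalisation cell (harness21).  Prover seat hodgecm-mathlib-K2Liu-p05 (g0): Track B «K2-LIT»,
#184♮ = hLiu418 = stmt-HodgeConjecture-24832; socket #32d `sig_K2LiuDoublingHeightDecayLocal` of `Cruxes/HLiu418/Lines/K2_Liu_CurveThetaSigs_U5d_ZetaS.lean`
(ED. 1 a836627a4002dcd3 :224) — the split finite slice modulo its torus decay; K2/STATUS 2026-09-04 (K2Liu-p05 (g0)).
-/
import Summits.HodgeConjecture.HodgeConjecture.Theorems.K2LiuSplitCosetCount   -- ★ (V) coset counts, transport, volumes; (A2), (LT) transitively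
import HarnessLib

/-!
# Crux `HLiu418`, road `K2_Liu`, unit U5d, socket #32d — THE SPLIT SLICE MODULO ITS TORUS DECAY

Cell `hodgecm-mathlib`, crux item hLiu418 = `stmt-HodgeConjecture-24832`; squad K2 ∕ K2Liu, LEAD F0P6-plan (g10), planner K2Liu-plan (g2), prover
K2Liu-p05 (g0).  THEOREMS ONLY (no `def` ∕ instance ∕ notation ∕ named-fact hypothesis ∕ `sorry`, default heartbeats); lane
`--supports stmt-HodgeConjecture-24832 --as helper` (count-neutral).

For a group `G` (the slice group `G_v = U(V)(L⁺_v)` of #32d at a place `v ∈ S` split in `L ∕ L⁺`) with a group isomorphism `e : G ≃* GL_N(F)`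
(★ `UnitaryGroup.localPiSplitEquiv`, `F = L_w`), put `K₀ = e⁻¹ GL_N(𝒪)` and `t_a = e⁻¹ ϖ^a`.  Then ([Macdonald1995, Ch. V §2 (2.6), (2.9)];
[GelbartPiatetskishapiroRallis1987, Part A §6]; [Li1992, §3 Thm. 3.1]; [Liu2011, §2C]):
* §1 `finite_and_ncard_cosets_transport_le`, `measure_doubleCoset_transport_le` — `ν(K₀ t_a K₀) ≤ ∏_i (|a_i|+1)^{2N} q^{(N−1)|a_i|} · ν(K₀)` for EVERY
  `a ∈ ℤ^N` and every left-invariant `ν` (★ (V) `finite_and_ncard_cosets_zpowDiagGL_le` transported by ★ `finite_and_ncard_image_mk_le_of_hom`,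
  ★ `measure_le_ncard_mul`);
* §2 **`summable_measure_doubleCoset_mul_of_torusDecay`** — if `ψ ≥ 0` satisfies the TORUS DECAY `ψ(t_a) ≤ C ∏_i s^{|a_i|}` with `s · q^{N−1} < 1`, the
  Cartan series `∑_{a antitone} ν(K₀ t_a K₀) ψ(t_a)` converges (majorant `ν(K₀)·C·∑_{a ∈ ℤ^N} ∏_i (|a_i|+1)^{2N} (s q^{N−1})^{|a_i|}`, ★ (LT)
  `summable_cartanLattice`);
* §3 **`integrable_of_quasiInvariant_of_torusDecay`** — with ★ (A2) `integrable_of_cartanSeries_of_isOpen` and the Cartan decomposition (★ (V)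
  `isCartanFamily_glInt_zpowDiagGL`, `isCartanFamily_of_mulEquiv`): a measurable `ψ ≥ 0` on `G`, quasi-bi-invariant under the compact open `K₀` and with
  the torus decay above, is `ν`-integrable.  For the split slice of #32d, `ψ(u) = Φ(ι(ιA(placesEmbed(1, u_v))))^τ` is quasi-bi-invariant by ★ (A1)
  `exists_placeSlice_quasiBiInvariant` (any compact pair), and `s = q^{−τ∕2}` satisfies `s·q^{N−1} = q^{(N−1)−τ∕2} < 1 ⟺ τ > 2N − 2` (★ (LT)
  `rpow_lt_one_of_sharp`) — so the split slice `_hfin v` of ★ (R) `doublingHeightDecayLocal_of_slices` is REDUCED TO THE TORUS DECAY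
  `Φ(ι(ιA(placesEmbed(1, (e⁻¹ϖ^a)_v)))) ≤ C′ q^{−Σ|a_i|∕2}` (organ (D): ★ `K2LiuSplitCartanIwasawa` + ★ `modDelta_locToAdelic` + ★ (EV)
  `exists_twoSided_modDelta_of_localDecomp`, through the local bridge (T1)).
No good-place hypothesis: `K₀ = e⁻¹ GL_N(𝒪)` need not be `U(V)(𝒪_v)`.

HONEST LABEL.  Count-neutral helper: `HC_CM` is proved only modulo the 7 printed citations (2 remaining named inputs: hLiu418 =
`stmt-HodgeConjecture-24832`, h413 = `stmt-HodgeConjecture-24833`) until rung 0 closes; the torus decay (D), the non-split places and the archimedean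
slice of #32d remain.

References: [Macdonald1995] I. G. Macdonald, *Symmetric functions and Hall polynomials*, Ch. V §2; [GelbartPiatetskishapiroRallis1987] LNM 1254, Part A §6;
[Li1992] J.-S. Li, J. reine angew. Math. 428, §3 Thm. 3.1; [Liu2011] Y. Liu, Algebra Number Theory 5 (2011), §2C; [CartierCorvallis1979] PSPM 33.1, §IV.2.
-/

set_option autoImplicit false
-- the mandated namespace repeats the single-problem summit's segment (`HodgeConjecture.HodgeConjecture`)
set_option linter.dupNamespace false

noncomputable section

open scoped ENNReal
open MeasureTheory

namespace Summit.HodgeConjecture.HodgeConjecture.Cruxes.HLiu418.K2LiuSplitSliceCartanSeries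

open Literature.NumberTheory.K2Lit.SiegelDoubled
open Literature.NumberTheory.Automorphic
open ValuativeRel
open Summit.HodgeConjecture.HodgeConjecture.Cruxes.HLiu418.K2LiuSplitCosetCount
open Summit.HodgeConjecture.HodgeConjecture.Cruxes.HLiu418.K2LiuDoublingHeightSliceCartanBound
open Summit.HodgeConjecture.HodgeConjecture.Cruxes.HLiu418.K2LiuCartanLatticeSummable

variable {G : Type} [Group G] {F : Type} [Field F] [ValuativeRel F] {n : ℕ} {ϖ : F}

/-! ## §1 Counts and volumes of the transported double cosets `K₀ e⁻¹(ϖ^a) K₀` -/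

/-- **`#(K₀ e⁻¹ϖ^a K₀ ∕ K₀) ≤ ∏_i (|a_i|+1)^{2N} q^{(N−1)|a_i|}`** through `e : G ≃* GL_N(F)` with `e⁻¹ GL_N(𝒪) = K₀` (and these cosets are finitely many).
[cite: Macdonald1995, Ch. V §2 (2.6), (2.9)] -/
theorem finite_and_ncard_cosets_transport_le [Finite 𝓀[F]] (hϖ : IsUniformizingElement ϖ) (e : G ≃* GL (Fin n) F) {K₀ : Subgroup G}
    (hK : ∀ x, e x ∈ glInt n F ↔ x ∈ K₀) (a : Fin n → ℤ) :
    (QuotientGroup.mk '' DoubleCoset.doubleCoset (e.symm (zpowDiagGL hϖ.ne_zero a)) (K₀ : Set G) K₀ : Set (G ⧸ K₀)).Finite ∧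
      (QuotientGroup.mk '' DoubleCoset.doubleCoset (e.symm (zpowDiagGL hϖ.ne_zero a)) (K₀ : Set G) K₀ : Set (G ⧸ K₀)).ncard ≤
        ∏ i, ((a i).natAbs + 1) ^ (2 * n) * Nat.card 𝓀[F] ^ ((n - 1) * (a i).natAbs) := by
  have himg : (e.toMonoidHom : G → GL (Fin n) F) '' DoubleCoset.doubleCoset (e.symm (zpowDiagGL hϖ.ne_zero a)) (K₀ : Set G) K₀ =
      DoubleCoset.doubleCoset (zpowDiagGL hϖ.ne_zero a) (glInt n F : Set (GL (Fin n) F)) (glInt n F) := by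
    rw [MulEquiv.coe_toMonoidHom]
    exact image_doubleCoset_symm e hK _
  obtain ⟨hf, hle⟩ := finite_and_ncard_cosets_zpowDiagGL_le (n := n) hϖ a
  have h := finite_and_ncard_image_mk_le_of_hom K₀ (glInt n F) e.toMonoidHom hK
    (DoubleCoset.doubleCoset (e.symm (zpowDiagGL hϖ.ne_zero a)) (K₀ : Set G) K₀) (by rw [himg]; exact hf)
  rw [himg] at h
  exact ⟨h.1, h.2.trans hle⟩

/-- **`ν(K₀ e⁻¹ϖ^a K₀) ≤ ∏_i (|a_i|+1)^{2N} q^{(N−1)|a_i|} · ν(K₀)`** for a left-invariant measure `ν` on `G`.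
[cite: Macdonald1995, Ch. V §2 (2.9)] -/
theorem measure_doubleCoset_transport_le [Finite 𝓀[F]] (hϖ : IsUniformizingElement ϖ) [MeasurableSpace G] [MeasurableMul G] (ν : Measure G)
    [ν.IsMulLeftInvariant] (e : G ≃* GL (Fin n) F) {K₀ : Subgroup G} (hK : ∀ x, e x ∈ glInt n F ↔ x ∈ K₀) (a : Fin n → ℤ) :
    ν (DoubleCoset.doubleCoset (e.symm (zpowDiagGL hϖ.ne_zero a)) (K₀ : Set G) K₀) ≤
      ((∏ i, ((a i).natAbs + 1) ^ (2 * n) * Nat.card 𝓀[F] ^ ((n - 1) * (a i).natAbs) : ℕ) : ℝ≥0∞) * ν K₀ := by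
  obtain ⟨hf, hle⟩ := finite_and_ncard_cosets_transport_le hϖ e hK a
  exact (measure_le_ncard_mul ν K₀ _ hf).trans (mul_le_mul' (by exact_mod_cast hle) le_rfl)

/-! ## §2 Convergence of the Cartan series from a torus decay -/

/-- cast of the count bound to `ℝ`: `∏_i (|a_i|+1)^{2N} q^{(N−1)|a_i|}` as a real number. [folklore] -/
theorem cast_countBound (a : Fin n → ℤ) (q : ℕ) :
    (((∏ i, ((a i).natAbs + 1) ^ (2 * n) * q ^ ((n - 1) * (a i).natAbs) : ℕ)) : ℝ) =
      ∏ i, ((|a i| : ℝ) + 1) ^ (2 * n) * ((q : ℝ) ^ (n - 1)) ^ (a i).natAbs := by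
  rw [Nat.cast_prod]
  refine Finset.prod_congr rfl fun i _ => ?_
  rw [Nat.cast_mul, Nat.cast_pow, Nat.cast_pow, Nat.cast_add, Nat.cast_one, Nat.cast_natAbs, Int.cast_abs, ← pow_mul]

/-- **convergence of the Cartan series from a torus decay**: if `ψ ≥ 0` on `G` satisfies `ψ(e⁻¹ϖ^a) ≤ C ∏_i s^{|a_i|}` for all `a ∈ ℤ^N` with
`0 ≤ s`, `s · q^{N−1} < 1`, and `ν(K₀) < ∞`, then `∑_{a antitone} ν(K₀ e⁻¹ϖ^a K₀) · ψ(e⁻¹ϖ^a) < ∞` — majorant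
`ν(K₀) C ∑_{a ∈ ℤ^N} ∏_i (|a_i|+1)^{2N} (s q^{N−1})^{|a_i|}` (★ `summable_cartanLattice`).  For the slice of #32d, `s = q^{−τ∕2}` and the condition is
`τ > 2N − 2`. [cite: GelbartPiatetskishapiroRallis1987, Part A §6] [cite: Li1992, §3 Thm. 3.1] [cite: Macdonald1995, Ch. V (2.9)] -/
theorem summable_measure_doubleCoset_mul_of_torusDecay [Finite 𝓀[F]] (hϖ : IsUniformizingElement ϖ) [MeasurableSpace G] [MeasurableMul G]
    (ν : Measure G) [ν.IsMulLeftInvariant] (e : G ≃* GL (Fin n) F) {K₀ : Subgroup G} (hK : ∀ x, e x ∈ glInt n F ↔ x ∈ K₀) (hK₀ : ν K₀ ≠ ∞)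
    {ψ : G → ℝ} (hψ0 : ∀ g, 0 ≤ ψ g) {C s : ℝ} (hs0 : 0 ≤ s) (hs1 : s * (Nat.card 𝓀[F] : ℝ) ^ (n - 1) < 1)
    (hψ : ∀ a : Fin n → ℤ, ψ (e.symm (zpowDiagGL hϖ.ne_zero a)) ≤ C * ∏ i, s ^ (a i).natAbs) :
    Summable fun a : {a : Fin n → ℤ // Antitone a} =>
      (ν (DoubleCoset.doubleCoset (e.symm (zpowDiagGL hϖ.ne_zero a.1)) (K₀ : Set G) K₀)).toReal * ψ (e.symm (zpowDiagGL hϖ.ne_zero a.1)) := by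
  have hq0 : (0 : ℝ) ≤ (Nat.card 𝓀[F] : ℝ) ^ (n - 1) := pow_nonneg (Nat.cast_nonneg _) _
  -- the majorant over all of `ℤ^N`
  have hmaj : ∀ a : Fin n → ℤ,
      (ν (DoubleCoset.doubleCoset (e.symm (zpowDiagGL hϖ.ne_zero a)) (K₀ : Set G) K₀)).toReal * ψ (e.symm (zpowDiagGL hϖ.ne_zero a)) ≤
        (ν K₀).toReal * C * ∏ i, ((|a i| : ℝ) + 1) ^ (2 * n) * (s * (Nat.card 𝓀[F] : ℝ) ^ (n - 1)) ^ (a i).natAbs := by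
    intro a
    have hvol : (ν (DoubleCoset.doubleCoset (e.symm (zpowDiagGL hϖ.ne_zero a)) (K₀ : Set G) K₀)).toReal ≤
        (∏ i, ((|a i| : ℝ) + 1) ^ (2 * n) * ((Nat.card 𝓀[F] : ℝ) ^ (n - 1)) ^ (a i).natAbs) * (ν K₀).toReal := by
      rw [← cast_countBound a (Nat.card 𝓀[F]), ← ENNReal.toReal_natCast, ← ENNReal.toReal_mul]
      exact ENNReal.toReal_mono (ENNReal.mul_ne_top (ENNReal.natCast_ne_top _) hK₀) (measure_doubleCoset_transport_le hϖ ν e hK a)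
    have hcnt0 : 0 ≤ ∏ i, ((|a i| : ℝ) + 1) ^ (2 * n) * ((Nat.card 𝓀[F] : ℝ) ^ (n - 1)) ^ (a i).natAbs :=
      Finset.prod_nonneg fun i _ => mul_nonneg (pow_nonneg (by positivity) _) (pow_nonneg hq0 _)
    calc (ν (DoubleCoset.doubleCoset (e.symm (zpowDiagGL hϖ.ne_zero a)) (K₀ : Set G) K₀)).toReal * ψ (e.symm (zpowDiagGL hϖ.ne_zero a))
        ≤ ((∏ i, ((|a i| : ℝ) + 1) ^ (2 * n) * ((Nat.card 𝓀[F] : ℝ) ^ (n - 1)) ^ (a i).natAbs) * (ν K₀).toReal) *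
            (C * ∏ i, s ^ (a i).natAbs) :=
          mul_le_mul hvol (hψ a) (hψ0 _) (mul_nonneg hcnt0 ENNReal.toReal_nonneg)
      _ = (ν K₀).toReal * C * ∏ i, ((|a i| : ℝ) + 1) ^ (2 * n) * (s * (Nat.card 𝓀[F] : ℝ) ^ (n - 1)) ^ (a i).natAbs := by
          rw [mul_comm _ (ν K₀).toReal, mul_assoc, mul_left_comm _ C, ← mul_assoc, ← Finset.prod_mul_distrib]
          refine congrArg _ (Finset.prod_congr rfl fun i _ => ?_)
          rw [mul_pow]
          ring
  have hsum : Summable fun a : Fin n → ℤ =>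
      (ν K₀).toReal * C * ∏ i, ((|a i| : ℝ) + 1) ^ (2 * n) * (s * (Nat.card 𝓀[F] : ℝ) ^ (n - 1)) ^ (a i).natAbs :=
    (summable_cartanLattice n (2 * n) (mul_nonneg hs0 hq0) hs1).mul_left _
  refine Summable.of_nonneg_of_le (fun a => mul_nonneg ENNReal.toReal_nonneg (hψ0 _)) (fun a => hmaj a.1) (hsum.subtype _)

/-! ## §3 The split slice modulo its torus decay -/

/-- **integrability from quasi-bi-invariance and torus decay** (the split finite slice of #32d modulo organ (D)): on a topological group `G` with a
left-invariant Borel measure `ν` finite on compacts, let `e : G ≃* GL_N(F)` be a group isomorphism with `K₀ = e⁻¹ GL_N(𝒪)` compact open.  A measurable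
`ψ ≥ 0` which is quasi-bi-invariant under `K₀` (`ψ(x g y) ≤ c ψ(g)`, `x, y ∈ K₀` — ★ (A1)) and decays along the torus, `ψ(e⁻¹ϖ^a) ≤ C ∏_i s^{|a_i|}`
with `s · q^{N−1} < 1`, is `ν`-integrable: Cartan decomposition `G = ⨆_{a antitone} K₀ e⁻¹ϖ^a K₀` (★ (V)), `∫ ψ ≤ c ∑_a ν(K₀ e⁻¹ϖ^a K₀) ψ(e⁻¹ϖ^a)` (★ (A2))
and §2. [cite: GelbartPiatetskishapiroRallis1987, Part A §6] [cite: Li1992, §3 Thm. 3.1] [cite: Liu2011, §2C] -/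
theorem integrable_of_quasiInvariant_of_torusDecay [Finite 𝓀[F]] [IsDiscreteValuationRing 𝒪[F]] (hϖ : IsUniformizingElement ϖ)
    [TopologicalSpace G] [IsTopologicalGroup G] [MeasurableSpace G] [BorelSpace G] (ν : Measure G) [ν.IsMulLeftInvariant]
    [IsFiniteMeasureOnCompacts ν] (e : G ≃* GL (Fin n) F) {K₀ : Subgroup G} (hK : ∀ x, e x ∈ glInt n F ↔ x ∈ K₀)
    (hK₀o : IsOpen (K₀ : Set G)) (hK₀c : IsCompact (K₀ : Set G))
    {ψ : G → ℝ} (hψm : AEStronglyMeasurable ψ ν) (hψ0 : ∀ g, 0 ≤ ψ g)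
    {c : ℝ} (hc : 0 ≤ c) (hquasi : ∀ x ∈ K₀, ∀ y ∈ K₀, ∀ g : G, ψ (x * g * y) ≤ c * ψ g)
    {C s : ℝ} (hs0 : 0 ≤ s) (hs1 : s * (Nat.card 𝓀[F] : ℝ) ^ (n - 1) < 1)
    (hdecay : ∀ a : Fin n → ℤ, ψ (e.symm (zpowDiagGL hϖ.ne_zero a)) ≤ C * ∏ i, s ^ (a i).natAbs) :
    Integrable ψ ν := by
  refine integrable_of_cartanSeries_of_isOpen ν hK₀o (isCartanFamily_of_mulEquiv e hK (isCartanFamily_glInt_zpowDiagGL hϖ)) (fun a => ?_)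
    hψm hψ0 hc hquasi (summable_measure_doubleCoset_mul_of_torusDecay hϖ ν e hK hK₀c.measure_lt_top.ne hψ0 hs0 hs1 hdecay)
  -- the double cosets `K₀ t K₀ = K₀ · {t} · K₀` are compact
  exact ((hK₀c.mul isCompact_singleton).mul hK₀c).measure_lt_top.ne

end Summit.HodgeConjecture.HodgeConjecture.Cruxes.HLiu418.K2LiuSplitSliceCartanSeries

end
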